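import Summits.RiemannHypothesis.RiemannHypothesis.Theorems.SemilocalNegCertUptoHundredThirtyOneKinkedB
import Summits.RiemannHypothesis.RiemannHypothesis.Theorems.SemilocalNegCertUptoHundredThirtyOneKinkedC
import Summits.RiemannHypothesis.RiemannHypothesis.Theorems.SemilocalNegCertUptoHundredThirtyOneKinkedD
import Summits.RiemannHypothesis.RiemannHypothesis.Theorems.SemilocalNegCertUptoHundredThirtyOneKinkedE
import Summits.RiemannHypothesis.RiemannHypothesis.Theorems.SemilocalNegCertUptoHundredThirtyOneKinkedF
import Summits.RiemannHypothesis.RiemannHypothesis.Theorems.SemilocalNegCertUptoHundredThirtyOneKinkedG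
import HarnessLib

/-!
# Semi-local threshold of the `{∞} ∪ {p < 137}` form, negative side: `a*({2,…,131}) ≤ 1263/512` — the wall `q = 137` from a KINKED (piecewise-cubic) witness (part 10/14: the composition of the piece facts 0 … 149)

Cell `rh-explicit` (HOME `run/shared/lean/pub/rh-explicit/`), seat cc-s2-4 (A4 SEMILOCAL-TABLE, kernel column; pipeline gen11 `mkkinked.py`).
Honest framing: theorems about the tree's `weilSemilocalThreshold S`; nothing here bears on RH.  No data is trusted: every bound is a
`decide +kernel` fact of the piecewise certificate `SemilocalPiecewiseCert.lean` (cc-s2-4 gen8).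

Instance: `S = {p < 137}`, window `b = 1263/512` (last /1024 value below `(log 139)/2`), `N = 138`, 45 atoms; odd piecewise-cubic
witness with 20 slope breaks at the atom images `|b − log n|` nearest `0` (atoms `n = 11, 13, 9, 16, 17, 8, 19, 7, 23, 25, 27, 5, 29, 31, 32, 4, 37, 41, 43, 3`,
rounded to `/1024`); float finder `Re Q/‖G‖² = -2.626e-04` (no polar credit); orders `(10, 4, 8, 4, 10, 40)`, 437 `t`-pieces
(far widths ≤ 1/4); exact kernel margin `(rhs − lhs)/‖G‖² = 2.6311e-04`.  ⇒ **`a*({p < 137}) ≤ 1263/512 < (log 139)/2`**.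
The instance is split for the gate into part 1
(table, certificate, `checkMainPW`, the atom side in kernel chunks of ≤ 4 atoms via `SemilocalPiecewiseCertSplit.lean`), parts 2–8
(68 piece facts each in the FLEX layout of `SemilocalPiecewiseCertFlex.lean` (cc-s2-4 gen12, CC4-LEAN §17.2): piece `0` by `checkPiecePW`,
every far piece by `checkPieceFlex i ⟨n, m, K, m', u₀⟩` with the orders that piece needs (mean majorant degree ≈ 62 instead of 176) and a
short dyadic centre `u₀ ≤ u_K(T₀)` — same witness, same cuts, claims recomputed (`⌈exact⌉ + 1`), kernel margin `2.6309e-04`·‖G‖²; each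
fact file imports part 1 only), the Pieces part (composition) and the Final part (theorems).  Folklore throughout.
-/

set_option autoImplicit false
set_option linter.dupNamespace false  -- the mandated namespace repeats `RiemannHypothesis`
set_option Elab.async false  -- serialise the kernel facts: in parallel they exhaust the node's per-process heap (cc-s2-4 gen11, CC4-LEAN §16.10)

noncomputable section

open Complex Filter Set MeasureTheory Topology
open scoped Real

namespace Summit.RiemannHypothesis.RiemannHypothesis.Theorems.SemilocalPolyWitness

open MeasureTheory Set Finset Real
open Literature.NumberTheory.LFunctions
open Summit.RiemannHypothesis.RiemannHypothesis.Theorems.MotivicDoor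
open Summit.RiemannHypothesis.RiemannHypothesis.Theorems.MotivicDoor.SemilocalThreshold
open Summit.RiemannHypothesis.RiemannHypothesis.Theorems.MotivicDoor.SemilocalMarkov
open LQ

/-- pieces `0 ≤ i < 150` of `certUptoHundredThirtyOneKinked` check (FLEX form). -/
theorem check_UptoHundredThirtyOneKinked_pieces_1 : ∀ i, 0 ≤ i → i < 150 →
    certUptoHundredThirtyOneKinked.checkPiecePW i = true ∨ ∃ o, certUptoHundredThirtyOneKinked.checkPieceFlex i o = true := by
  intro i hlo hhi
  interval_cases i
  · exact Or.inl check_UptoHundredThirtyOneKinked_piece0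
  · exact Or.inr ⟨_, check_UptoHundredThirtyOneKinked_piece1⟩
  · exact Or.inr ⟨_, check_UptoHundredThirtyOneKinked_piece2⟩
  · exact Or.inr ⟨_, check_UptoHundredThirtyOneKinked_piece3⟩
  · exact Or.inr ⟨_, check_UptoHundredThirtyOneKinked_piece4⟩
  · exact Or.inr ⟨_, check_UptoHundredThirtyOneKinked_piece5⟩
  · exact Or.inr ⟨_, check_UptoHundredThirtyOneKinked_piece6⟩
  · exact Or.inr ⟨_, check_UptoHundredThirtyOneKinked_piece7⟩
  · exact Or.inr ⟨_, check_UptoHundredThirtyOneKinked_piece8⟩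
  · exact Or.inr ⟨_, check_UptoHundredThirtyOneKinked_piece9⟩
  · exact Or.inr ⟨_, check_UptoHundredThirtyOneKinked_piece10⟩
  · exact Or.inr ⟨_, check_UptoHundredThirtyOneKinked_piece11⟩
  · exact Or.inr ⟨_, check_UptoHundredThirtyOneKinked_piece12⟩
  · exact Or.inr ⟨_, check_UptoHundredThirtyOneKinked_piece13⟩
  · exact Or.inr ⟨_, check_UptoHundredThirtyOneKinked_piece14⟩
  · exact Or.inr ⟨_, check_UptoHundredThirtyOneKinked_piece15⟩
  · exact Or.inr ⟨_, check_UptoHundredThirtyOneKinked_piece16⟩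
  · exact Or.inr ⟨_, check_UptoHundredThirtyOneKinked_piece17⟩
  · exact Or.inr ⟨_, check_UptoHundredThirtyOneKinked_piece18⟩
  · exact Or.inr ⟨_, check_UptoHundredThirtyOneKinked_piece19⟩
  · exact Or.inr ⟨_, check_UptoHundredThirtyOneKinked_piece20⟩
  · exact Or.inr ⟨_, check_UptoHundredThirtyOneKinked_piece21⟩
  · exact Or.inr ⟨_, check_UptoHundredThirtyOneKinked_piece22⟩
  · exact Or.inr ⟨_, check_UptoHundredThirtyOneKinked_piece23⟩
  · exact Or.inr ⟨_, check_UptoHundredThirtyOneKinked_piece24⟩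
  · exact Or.inr ⟨_, check_UptoHundredThirtyOneKinked_piece25⟩
  · exact Or.inr ⟨_, check_UptoHundredThirtyOneKinked_piece26⟩
  · exact Or.inr ⟨_, check_UptoHundredThirtyOneKinked_piece27⟩
  · exact Or.inr ⟨_, check_UptoHundredThirtyOneKinked_piece28⟩
  · exact Or.inr ⟨_, check_UptoHundredThirtyOneKinked_piece29⟩
  · exact Or.inr ⟨_, check_UptoHundredThirtyOneKinked_piece30⟩
  · exact Or.inr ⟨_, check_UptoHundredThirtyOneKinked_piece31⟩
  · exact Or.inr ⟨_, check_UptoHundredThirtyOneKinked_piece32⟩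
  · exact Or.inr ⟨_, check_UptoHundredThirtyOneKinked_piece33⟩
  · exact Or.inr ⟨_, check_UptoHundredThirtyOneKinked_piece34⟩
  · exact Or.inr ⟨_, check_UptoHundredThirtyOneKinked_piece35⟩
  · exact Or.inr ⟨_, check_UptoHundredThirtyOneKinked_piece36⟩
  · exact Or.inr ⟨_, check_UptoHundredThirtyOneKinked_piece37⟩
  · exact Or.inr ⟨_, check_UptoHundredThirtyOneKinked_piece38⟩
  · exact Or.inr ⟨_, check_UptoHundredThirtyOneKinked_piece39⟩
  · exact Or.inr ⟨_, check_UptoHundredThirtyOneKinked_piece40⟩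
  · exact Or.inr ⟨_, check_UptoHundredThirtyOneKinked_piece41⟩
  · exact Or.inr ⟨_, check_UptoHundredThirtyOneKinked_piece42⟩
  · exact Or.inr ⟨_, check_UptoHundredThirtyOneKinked_piece43⟩
  · exact Or.inr ⟨_, check_UptoHundredThirtyOneKinked_piece44⟩
  · exact Or.inr ⟨_, check_UptoHundredThirtyOneKinked_piece45⟩
  · exact Or.inr ⟨_, check_UptoHundredThirtyOneKinked_piece46⟩
  · exact Or.inr ⟨_, check_UptoHundredThirtyOneKinked_piece47⟩
  · exact Or.inr ⟨_, check_UptoHundredThirtyOneKinked_piece48⟩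
  · exact Or.inr ⟨_, check_UptoHundredThirtyOneKinked_piece49⟩
  · exact Or.inr ⟨_, check_UptoHundredThirtyOneKinked_piece50⟩
  · exact Or.inr ⟨_, check_UptoHundredThirtyOneKinked_piece51⟩
  · exact Or.inr ⟨_, check_UptoHundredThirtyOneKinked_piece52⟩
  · exact Or.inr ⟨_, check_UptoHundredThirtyOneKinked_piece53⟩
  · exact Or.inr ⟨_, check_UptoHundredThirtyOneKinked_piece54⟩
  · exact Or.inr ⟨_, check_UptoHundredThirtyOneKinked_piece55⟩
  · exact Or.inr ⟨_, check_UptoHundredThirtyOneKinked_piece56⟩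
  · exact Or.inr ⟨_, check_UptoHundredThirtyOneKinked_piece57⟩
  · exact Or.inr ⟨_, check_UptoHundredThirtyOneKinked_piece58⟩
  · exact Or.inr ⟨_, check_UptoHundredThirtyOneKinked_piece59⟩
  · exact Or.inr ⟨_, check_UptoHundredThirtyOneKinked_piece60⟩
  · exact Or.inr ⟨_, check_UptoHundredThirtyOneKinked_piece61⟩
  · exact Or.inr ⟨_, check_UptoHundredThirtyOneKinked_piece62⟩
  · exact Or.inr ⟨_, check_UptoHundredThirtyOneKinked_piece63⟩
  · exact Or.inr ⟨_, check_UptoHundredThirtyOneKinked_piece64⟩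
  · exact Or.inr ⟨_, check_UptoHundredThirtyOneKinked_piece65⟩
  · exact Or.inr ⟨_, check_UptoHundredThirtyOneKinked_piece66⟩
  · exact Or.inr ⟨_, check_UptoHundredThirtyOneKinked_piece67⟩
  · exact Or.inr ⟨_, check_UptoHundredThirtyOneKinked_piece68⟩
  · exact Or.inr ⟨_, check_UptoHundredThirtyOneKinked_piece69⟩
  · exact Or.inr ⟨_, check_UptoHundredThirtyOneKinked_piece70⟩
  · exact Or.inr ⟨_, check_UptoHundredThirtyOneKinked_piece71⟩
  · exact Or.inr ⟨_, check_UptoHundredThirtyOneKinked_piece72⟩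
  · exact Or.inr ⟨_, check_UptoHundredThirtyOneKinked_piece73⟩
  · exact Or.inr ⟨_, check_UptoHundredThirtyOneKinked_piece74⟩
  · exact Or.inr ⟨_, check_UptoHundredThirtyOneKinked_piece75⟩
  · exact Or.inr ⟨_, check_UptoHundredThirtyOneKinked_piece76⟩
  · exact Or.inr ⟨_, check_UptoHundredThirtyOneKinked_piece77⟩
  · exact Or.inr ⟨_, check_UptoHundredThirtyOneKinked_piece78⟩
  · exact Or.inr ⟨_, check_UptoHundredThirtyOneKinked_piece79⟩
  · exact Or.inr ⟨_, check_UptoHundredThirtyOneKinked_piece80⟩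
  · exact Or.inr ⟨_, check_UptoHundredThirtyOneKinked_piece81⟩
  · exact Or.inr ⟨_, check_UptoHundredThirtyOneKinked_piece82⟩
  · exact Or.inr ⟨_, check_UptoHundredThirtyOneKinked_piece83⟩
  · exact Or.inr ⟨_, check_UptoHundredThirtyOneKinked_piece84⟩
  · exact Or.inr ⟨_, check_UptoHundredThirtyOneKinked_piece85⟩
  · exact Or.inr ⟨_, check_UptoHundredThirtyOneKinked_piece86⟩
  · exact Or.inr ⟨_, check_UptoHundredThirtyOneKinked_piece87⟩
  · exact Or.inr ⟨_, check_UptoHundredThirtyOneKinked_piece88⟩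
  · exact Or.inr ⟨_, check_UptoHundredThirtyOneKinked_piece89⟩
  · exact Or.inr ⟨_, check_UptoHundredThirtyOneKinked_piece90⟩
  · exact Or.inr ⟨_, check_UptoHundredThirtyOneKinked_piece91⟩
  · exact Or.inr ⟨_, check_UptoHundredThirtyOneKinked_piece92⟩
  · exact Or.inr ⟨_, check_UptoHundredThirtyOneKinked_piece93⟩
  · exact Or.inr ⟨_, check_UptoHundredThirtyOneKinked_piece94⟩
  · exact Or.inr ⟨_, check_UptoHundredThirtyOneKinked_piece95⟩
  · exact Or.inr ⟨_, check_UptoHundredThirtyOneKinked_piece96⟩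
  · exact Or.inr ⟨_, check_UptoHundredThirtyOneKinked_piece97⟩
  · exact Or.inr ⟨_, check_UptoHundredThirtyOneKinked_piece98⟩
  · exact Or.inr ⟨_, check_UptoHundredThirtyOneKinked_piece99⟩
  · exact Or.inr ⟨_, check_UptoHundredThirtyOneKinked_piece100⟩
  · exact Or.inr ⟨_, check_UptoHundredThirtyOneKinked_piece101⟩
  · exact Or.inr ⟨_, check_UptoHundredThirtyOneKinked_piece102⟩
  · exact Or.inr ⟨_, check_UptoHundredThirtyOneKinked_piece103⟩
  · exact Or.inr ⟨_, check_UptoHundredThirtyOneKinked_piece104⟩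
  · exact Or.inr ⟨_, check_UptoHundredThirtyOneKinked_piece105⟩
  · exact Or.inr ⟨_, check_UptoHundredThirtyOneKinked_piece106⟩
  · exact Or.inr ⟨_, check_UptoHundredThirtyOneKinked_piece107⟩
  · exact Or.inr ⟨_, check_UptoHundredThirtyOneKinked_piece108⟩
  · exact Or.inr ⟨_, check_UptoHundredThirtyOneKinked_piece109⟩
  · exact Or.inr ⟨_, check_UptoHundredThirtyOneKinked_piece110⟩
  · exact Or.inr ⟨_, check_UptoHundredThirtyOneKinked_piece111⟩
  · exact Or.inr ⟨_, check_UptoHundredThirtyOneKinked_piece112⟩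
  · exact Or.inr ⟨_, check_UptoHundredThirtyOneKinked_piece113⟩
  · exact Or.inr ⟨_, check_UptoHundredThirtyOneKinked_piece114⟩
  · exact Or.inr ⟨_, check_UptoHundredThirtyOneKinked_piece115⟩
  · exact Or.inr ⟨_, check_UptoHundredThirtyOneKinked_piece116⟩
  · exact Or.inr ⟨_, check_UptoHundredThirtyOneKinked_piece117⟩
  · exact Or.inr ⟨_, check_UptoHundredThirtyOneKinked_piece118⟩
  · exact Or.inr ⟨_, check_UptoHundredThirtyOneKinked_piece119⟩
  · exact Or.inr ⟨_, check_UptoHundredThirtyOneKinked_piece120⟩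
  · exact Or.inr ⟨_, check_UptoHundredThirtyOneKinked_piece121⟩
  · exact Or.inr ⟨_, check_UptoHundredThirtyOneKinked_piece122⟩
  · exact Or.inr ⟨_, check_UptoHundredThirtyOneKinked_piece123⟩
  · exact Or.inr ⟨_, check_UptoHundredThirtyOneKinked_piece124⟩
  · exact Or.inr ⟨_, check_UptoHundredThirtyOneKinked_piece125⟩
  · exact Or.inr ⟨_, check_UptoHundredThirtyOneKinked_piece126⟩
  · exact Or.inr ⟨_, check_UptoHundredThirtyOneKinked_piece127⟩
  · exact Or.inr ⟨_, check_UptoHundredThirtyOneKinked_piece128⟩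
  · exact Or.inr ⟨_, check_UptoHundredThirtyOneKinked_piece129⟩
  · exact Or.inr ⟨_, check_UptoHundredThirtyOneKinked_piece130⟩
  · exact Or.inr ⟨_, check_UptoHundredThirtyOneKinked_piece131⟩
  · exact Or.inr ⟨_, check_UptoHundredThirtyOneKinked_piece132⟩
  · exact Or.inr ⟨_, check_UptoHundredThirtyOneKinked_piece133⟩
  · exact Or.inr ⟨_, check_UptoHundredThirtyOneKinked_piece134⟩
  · exact Or.inr ⟨_, check_UptoHundredThirtyOneKinked_piece135⟩
  · exact Or.inr ⟨_, check_UptoHundredThirtyOneKinked_piece136⟩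
  · exact Or.inr ⟨_, check_UptoHundredThirtyOneKinked_piece137⟩
  · exact Or.inr ⟨_, check_UptoHundredThirtyOneKinked_piece138⟩
  · exact Or.inr ⟨_, check_UptoHundredThirtyOneKinked_piece139⟩
  · exact Or.inr ⟨_, check_UptoHundredThirtyOneKinked_piece140⟩
  · exact Or.inr ⟨_, check_UptoHundredThirtyOneKinked_piece141⟩
  · exact Or.inr ⟨_, check_UptoHundredThirtyOneKinked_piece142⟩
  · exact Or.inr ⟨_, check_UptoHundredThirtyOneKinked_piece143⟩
  · exact Or.inr ⟨_, check_UptoHundredThirtyOneKinked_piece144⟩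
  · exact Or.inr ⟨_, check_UptoHundredThirtyOneKinked_piece145⟩
  · exact Or.inr ⟨_, check_UptoHundredThirtyOneKinked_piece146⟩
  · exact Or.inr ⟨_, check_UptoHundredThirtyOneKinked_piece147⟩
  · exact Or.inr ⟨_, check_UptoHundredThirtyOneKinked_piece148⟩
  · exact Or.inr ⟨_, check_UptoHundredThirtyOneKinked_piece149⟩

end Summit.RiemannHypothesis.RiemannHypothesis.Theorems.SemilocalPolyWitness

end
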